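import Literature.Barriers.Parity.SiegelZeroPrimePairsMainTermBoxes
import Mathlib.MeasureTheory.Integral.Bochner.Basic
import Mathlib.MeasureTheory.Measure.Lebesgue.Basic
import Mathlib.MeasureTheory.Function.ContinuousMapDense
import HarnessLib

/-!
# Matomäki–Merikoski §7, main term of `Σ̃_{S,S}`: the integrated box-sum identity

Sibling of `SiegelZeroPrimePairsMainTermBoxes.lean` (the pointwise identity).  Everything here is PROVED
(theorems only).  We integrate the pointwise identity `boxSum_pointwise_eq` in `y`:

  `∑_{i₁,i₂} ∑_{m₁ ≤ L₁, m₂ ≤ L₂} c₁(m₁)c₂(m₂)/(m₁m₂) ∫ f_{M₁,M₂}(m₁/M₁, m₂/M₂, y/(m₁N₁), (y+h)/(m₂N₂)) dy`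
  `= ∫ g(y/X)/log²X · B₁(y) B₂(y) dy`

(`MatomakiMerikoski.boxSum_integral_eq`; last display of p. 20 of arXiv:2112.11412), for continuous `g`
supported in `[1,2]` and continuous `𝔥` with `𝔥 ≡ 1` on `[1/20,20]`.  The only analytic input is that each
`y ↦ f_{M₁,M₂}(…y…)` is continuous with compact support (it vanishes for `y < X` and `y > 2X`, and the
logarithms are continuous on `y > 0`), hence integrable, so that the finite sums and the integral commute.

## References

* K. Matomäki, J. Merikoski, IMRN 2023:23, 20337–20384 (arXiv:2112.11412), §7, last display of p. 20.
  [cite: MatomakiMerikoski2023, §7 (main term of Σ_{S,S})]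
-/

noncomputable section

open Finset MeasureTheory

namespace Literature.Barriers.Parity.MatomakiMerikoski

open Literature.NumberTheory.Sieve

/-- A product `G · R` with `G` continuous and vanishing on `(−∞, X)` (`X > 0`) and `R` continuous on `(0, ∞)`
is continuous. [folklore] -/
theorem continuous_mul_of_eq_zero_of_continuousOn {G R : ℝ → ℝ} {X : ℝ} (hX : 0 < X) (hG : Continuous G)
    (hG0 : ∀ y, y < X → G y = 0) (hR : ContinuousOn R (Set.Ioi 0)) : Continuous fun y => G y * R y := by
  rw [continuous_iff_continuousAt]
  intro y₀
  by_cases hy : 0 < y₀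
  · exact (hG.continuousAt).mul (hR.continuousAt (Ioi_mem_nhds hy))
  · -- near `y₀ ≤ 0 < X` the product vanishes identically
    have hev : (fun y => G y * R y) =ᶠ[nhds y₀] fun _ => 0 := by
      have : Set.Iio X ∈ nhds y₀ := Iio_mem_nhds (by linarith)
      filter_upwards [this] with y hy'
      rw [hG0 y hy', zero_mul]
    rw [continuousAt_congr hev]
    exact continuousAt_const

/-- Each box term is a continuous function of `y` (for continuous `g` supported in `[1, 2]`, continuous `𝔥`,
`X > 0`, `h ≥ 0`, `m₁, m₂ ≥ 1`). [folklore] -/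
theorem continuous_boxWeight_apply {g 𝔥 : ℝ → ℝ} (hgc : Continuous g) (hg : ∀ t, g t ≠ 0 → 1 ≤ t ∧ t ≤ 2)
    (h𝔥c : Continuous 𝔥) {X h : ℝ} (hX : 0 < X) (hh : 0 ≤ h) (i₁ i₂ : ℤ) {m₁ m₂ : ℕ} (hm₁ : 1 ≤ m₁)
    (hm₂ : 1 ≤ m₂) :
    Continuous fun y : ℝ => boxWeight g 𝔥 X h i₁ i₂ ((m₁ : ℝ) / (2 : ℝ) ^ i₁) ((m₂ : ℝ) / (2 : ℝ) ^ i₂)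
      (y / ((m₁ : ℝ) * (X / (2 : ℝ) ^ i₁))) ((y + h) / ((m₂ : ℝ) * ((X + h) / (2 : ℝ) ^ i₂))) := by
  have hM₁ : (0 : ℝ) < (2 : ℝ) ^ i₁ := zpow_pos two_pos _
  have hm₁0 : (0 : ℝ) < m₁ := by exact_mod_cast hm₁
  -- write the term as `G(y) · R(y)` with `G(y) = g(y/X)`
  have hfac : ∀ y : ℝ, boxWeight g 𝔥 X h i₁ i₂ ((m₁ : ℝ) / (2 : ℝ) ^ i₁) ((m₂ : ℝ) / (2 : ℝ) ^ i₂)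
      (y / ((m₁ : ℝ) * (X / (2 : ℝ) ^ i₁))) ((y + h) / ((m₂ : ℝ) * ((X + h) / (2 : ℝ) ^ i₂))) =
      g (y / X) * (dyadicBump ((m₁ : ℝ) / (2 : ℝ) ^ i₁) * dyadicBump ((m₂ : ℝ) / (2 : ℝ) ^ i₂) *
        𝔥 (y / ((m₁ : ℝ) * (X / (2 : ℝ) ^ i₁))) * 𝔥 ((y + h) / ((m₂ : ℝ) * ((X + h) / (2 : ℝ) ^ i₂))) *
        (Real.log (y / ((m₁ : ℝ) * (X / (2 : ℝ) ^ i₁)) * (X / (2 : ℝ) ^ i₁)) *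
          Real.log ((y + h) / ((m₂ : ℝ) * ((X + h) / (2 : ℝ) ^ i₂)) * ((X + h) / (2 : ℝ) ^ i₂))) /
          Real.log X ^ 2) := by
    intro y
    rw [boxWeight_def]
    have e1 : (m₁ : ℝ) / (2 : ℝ) ^ i₁ * (y / ((m₁ : ℝ) * (X / (2 : ℝ) ^ i₁))) = y / X := by field_simp
    rw [e1]; ring
  simp_rw [hfac]
  refine continuous_mul_of_eq_zero_of_continuousOn hX (hgc.comp (continuous_id.div_const X)) ?_ ?_
  · intro y hy
    by_contra hne
    have := (hg (y / X) hne).1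
    rw [le_div_iff₀ hX] at this
    linarith
  · -- `R` is continuous on `(0, ∞)`: the logarithms have non-vanishing arguments there
    refine ContinuousOn.div_const (ContinuousOn.mul (ContinuousOn.mul ?_ ?_) (ContinuousOn.mul ?_ ?_)) _
    · exact ((continuous_const.mul (h𝔥c.comp (continuous_id.div_const _))).continuousOn)
    · exact (h𝔥c.comp ((continuous_id.add continuous_const).div_const _)).continuousOn
    · refine ContinuousOn.log ((continuous_id.div_const _).mul continuous_const).continuousOn ?_
      intro y hy
      rw [Set.mem_Ioi] at hy
      have : y / ((m₁ : ℝ) * (X / (2 : ℝ) ^ i₁)) * (X / (2 : ℝ) ^ i₁) = y / m₁ := by field_simp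
      rw [this]; positivity
    · refine ContinuousOn.log (((continuous_id.add continuous_const).div_const _).mul
        continuous_const).continuousOn ?_
      intro y hy
      rw [Set.mem_Ioi] at hy
      have hM₂ : (0 : ℝ) < (2 : ℝ) ^ i₂ := zpow_pos two_pos _
      have hm₂0 : (0 : ℝ) < m₂ := by exact_mod_cast hm₂
      have hXh : 0 < X + h := by linarith
      have : (y + h) / ((m₂ : ℝ) * ((X + h) / (2 : ℝ) ^ i₂)) * ((X + h) / (2 : ℝ) ^ i₂) = (y + h) / m₂ := by
        field_simp
      rw [this]; positivity

/-- Each box term vanishes for `y > 2X`. [folklore] -/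
theorem boxWeight_apply_eq_zero_of_lt {g 𝔥 : ℝ → ℝ} (hg : ∀ t, g t ≠ 0 → 1 ≤ t ∧ t ≤ 2) {X h : ℝ}
    (hX : 0 < X) (i₁ i₂ : ℤ) {m₁ : ℕ} (hm₁ : 1 ≤ m₁) (m₂ : ℕ) {y : ℝ} (hy : y < X ∨ 2 * X < y) :
    boxWeight g 𝔥 X h i₁ i₂ ((m₁ : ℝ) / (2 : ℝ) ^ i₁) ((m₂ : ℝ) / (2 : ℝ) ^ i₂)
      (y / ((m₁ : ℝ) * (X / (2 : ℝ) ^ i₁))) ((y + h) / ((m₂ : ℝ) * ((X + h) / (2 : ℝ) ^ i₂))) = 0 := by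
  have hM₁ : (0 : ℝ) < (2 : ℝ) ^ i₁ := zpow_pos two_pos _
  have hm₁0 : (0 : ℝ) < m₁ := by exact_mod_cast hm₁
  rw [boxWeight_def]
  have e1 : (m₁ : ℝ) / (2 : ℝ) ^ i₁ * (y / ((m₁ : ℝ) * (X / (2 : ℝ) ^ i₁))) = y / X := by field_simp
  rw [e1]
  have hg0 : g (y / X) = 0 := by
    by_contra hne
    obtain ⟨h1, h2⟩ := hg (y / X) hne
    rw [le_div_iff₀ hX] at h1
    rw [div_le_iff₀ hX] at h2
    rcases hy with hy | hy <;> linarith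
  rw [hg0]; ring

/-- Each box term is integrable in `y`. [folklore] -/
theorem integrable_boxWeight_apply {g 𝔥 : ℝ → ℝ} (hgc : Continuous g) (hg : ∀ t, g t ≠ 0 → 1 ≤ t ∧ t ≤ 2)
    (h𝔥c : Continuous 𝔥) {X h : ℝ} (hX : 0 < X) (hh : 0 ≤ h) (i₁ i₂ : ℤ) {m₁ m₂ : ℕ} (hm₁ : 1 ≤ m₁)
    (hm₂ : 1 ≤ m₂) :
    Integrable fun y : ℝ => boxWeight g 𝔥 X h i₁ i₂ ((m₁ : ℝ) / (2 : ℝ) ^ i₁) ((m₂ : ℝ) / (2 : ℝ) ^ i₂)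
      (y / ((m₁ : ℝ) * (X / (2 : ℝ) ^ i₁))) ((y + h) / ((m₂ : ℝ) * ((X + h) / (2 : ℝ) ^ i₂))) := by
  refine (continuous_boxWeight_apply hgc hg h𝔥c hX hh i₁ i₂ hm₁ hm₂).integrable_of_hasCompactSupport ?_
  refine HasCompactSupport.of_support_subset_isCompact (isCompact_Icc (a := X) (b := 2 * X)) ?_
  intro y hy
  rw [Function.mem_support] at hy
  rw [Set.mem_Icc]
  by_contra hc
  push Not at hc
  refine hy (boxWeight_apply_eq_zero_of_lt hg hX i₁ i₂ hm₁ m₂ ?_)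
  by_cases h1 : X ≤ y
  · exact Or.inr (hc h1)
  · exact Or.inl (not_le.mp h1)

/-- Range extension: the box sum over `m ≤ 4M` (`M = 2^i`) may be taken over `m ≤ L` for any `L ≥ 4M`, since
`F(m/M) = 0` for `m ≥ 4M`. [folklore] -/
theorem sum_Icc_floor_mul_dyadicBump_eq (t : ℕ → ℝ) (i : ℤ) {L : ℕ} (hL : 4 * (2 : ℝ) ^ i ≤ L) :
    ∑ m ∈ Icc 1 ⌊4 * (2 : ℝ) ^ i⌋₊, t m * dyadicBump ((m : ℝ) / (2 : ℝ) ^ i) =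
      ∑ m ∈ Icc 1 L, t m * dyadicBump ((m : ℝ) / (2 : ℝ) ^ i) := by
  have hM : (0 : ℝ) < (2 : ℝ) ^ i := zpow_pos two_pos _
  have hsub : Icc 1 ⌊4 * (2 : ℝ) ^ i⌋₊ ⊆ Icc 1 L := by
    intro m hm
    rw [mem_Icc] at hm ⊢
    refine ⟨hm.1, ?_⟩
    have : (⌊4 * (2 : ℝ) ^ i⌋₊ : ℝ) ≤ L := (Nat.floor_le (by positivity)).trans hL
    exact hm.2.trans (by exact_mod_cast this)
  refine sum_subset hsub fun m hm hm' => ?_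
  rw [mem_Icc] at hm hm'
  have hlt : ⌊4 * (2 : ℝ) ^ i⌋₊ < m := by
    by_contra hc
    exact hm' ⟨hm.1, not_lt.mp hc⟩
  have h4 : 4 ≤ (m : ℝ) / (2 : ℝ) ^ i := by
    rw [le_div_iff₀ hM]
    exact (Nat.lt_of_floor_lt hlt).le
  rw [dyadicBump_of_four_le h4, mul_zero]

/-- **Summing the boxes, integrated form** (Matomäki–Merikoski §7, last display of p. 20): for continuous
`g` supported in `[1,2]`, continuous `𝔥 ≡ 1` on `[1/20, 20]`, `X > 0`, `h ≥ 0`: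
`∑_{i₁,i₂} ∑_{m₁ ≤ L₁, m₂ ≤ L₂} c₁(m₁)c₂(m₂)/(m₁m₂) ∫ f_{M₁,M₂}(…) dy = ∫ g(y/X)/log²X · B₁(y) B₂(y) dy`.
[cite: MatomakiMerikoski2023, §7 (main term of Σ_{S,S}, last display of p. 20)] -/
theorem boxSum_integral_eq {g 𝔥 : ℝ → ℝ} (hgc : Continuous g) (hg : ∀ t, g t ≠ 0 → 1 ≤ t ∧ t ≤ 2)
    (h𝔥c : Continuous 𝔥) (h𝔥 : ∀ t, 1 / 20 ≤ t → t ≤ 20 → 𝔥 t = 1) {X h : ℝ} (hX : 0 < X) (hh : 0 ≤ h)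
    (b₁ b₂ : ℕ) (L₁ L₂ : ℕ) (c₁ c₂ : ℕ → ℝ) :
    ∑ i₁ ∈ Finset.Icc (-2 : ℤ) b₁, ∑ i₂ ∈ Finset.Icc (-2 : ℤ) b₂, ∑ m₁ ∈ Icc 1 L₁, ∑ m₂ ∈ Icc 1 L₂,
        c₁ m₁ * c₂ m₂ / ((m₁ : ℝ) * m₂) *
          ∫ y : ℝ, boxWeight g 𝔥 X h i₁ i₂ ((m₁ : ℝ) / (2 : ℝ) ^ i₁) ((m₂ : ℝ) / (2 : ℝ) ^ i₂)
            (y / ((m₁ : ℝ) * (X / (2 : ℝ) ^ i₁))) ((y + h) / ((m₂ : ℝ) * ((X + h) / (2 : ℝ) ^ i₂))) =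
      ∫ y : ℝ, g (y / X) / Real.log X ^ 2 *
        ((∑ m₁ ∈ Icc 1 L₁, c₁ m₁ * Real.log (y / m₁) / m₁ *
            ∑ i₁ ∈ Finset.Icc (-2 : ℤ) b₁, dyadicBump ((m₁ : ℝ) / (2 : ℝ) ^ i₁)) *
          ∑ m₂ ∈ Icc 1 L₂, c₂ m₂ * Real.log ((y + h) / m₂) / m₂ *
            ∑ i₂ ∈ Finset.Icc (-2 : ℤ) b₂, dyadicBump ((m₂ : ℝ) / (2 : ℝ) ^ i₂)) := by
  -- abbreviate the box term
  set T : ℤ → ℤ → ℕ → ℕ → ℝ → ℝ := fun i₁ i₂ m₁ m₂ y =>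
    c₁ m₁ * c₂ m₂ / ((m₁ : ℝ) * m₂) *
      boxWeight g 𝔥 X h i₁ i₂ ((m₁ : ℝ) / (2 : ℝ) ^ i₁) ((m₂ : ℝ) / (2 : ℝ) ^ i₂)
        (y / ((m₁ : ℝ) * (X / (2 : ℝ) ^ i₁))) ((y + h) / ((m₂ : ℝ) * ((X + h) / (2 : ℝ) ^ i₂))) with hT
  have hTi : ∀ i₁ i₂ : ℤ, ∀ m₁ ∈ Icc 1 L₁, ∀ m₂ ∈ Icc 1 L₂, Integrable (T i₁ i₂ m₁ m₂) := by
    intro i₁ i₂ m₁ hm₁ m₂ hm₂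
    rw [mem_Icc] at hm₁ hm₂
    exact (integrable_boxWeight_apply hgc hg h𝔥c hX hh i₁ i₂ hm₁.1 hm₂.1).const_mul _
  -- the right-hand side is the integral of the full finite sum (pointwise identity)
  have hpt : ∀ y : ℝ, g (y / X) / Real.log X ^ 2 *
        ((∑ m₁ ∈ Icc 1 L₁, c₁ m₁ * Real.log (y / m₁) / m₁ *
            ∑ i₁ ∈ Finset.Icc (-2 : ℤ) b₁, dyadicBump ((m₁ : ℝ) / (2 : ℝ) ^ i₁)) *
          ∑ m₂ ∈ Icc 1 L₂, c₂ m₂ * Real.log ((y + h) / m₂) / m₂ *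
            ∑ i₂ ∈ Finset.Icc (-2 : ℤ) b₂, dyadicBump ((m₂ : ℝ) / (2 : ℝ) ^ i₂)) =
      ∑ i₁ ∈ Finset.Icc (-2 : ℤ) b₁, ∑ i₂ ∈ Finset.Icc (-2 : ℤ) b₂, ∑ m₁ ∈ Icc 1 L₁, ∑ m₂ ∈ Icc 1 L₂,
        T i₁ i₂ m₁ m₂ y := fun y =>
    (boxSum_pointwise_eq hg h𝔥 hX hh b₁ b₂ L₁ L₂ c₁ c₂ y).symm
  simp_rw [hpt]
  -- commute the integral with the four finite sums
  rw [integral_finsetSum _ fun i₁ _ => integrable_finsetSum _ fun i₂ _ =>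
    integrable_finsetSum _ fun m₁ hm₁ => integrable_finsetSum _ fun m₂ hm₂ => hTi i₁ i₂ m₁ hm₁ m₂ hm₂]
  refine sum_congr rfl fun i₁ _ => ?_
  rw [integral_finsetSum _ fun i₂ _ =>
    integrable_finsetSum _ fun m₁ hm₁ => integrable_finsetSum _ fun m₂ hm₂ => hTi i₁ i₂ m₁ hm₁ m₂ hm₂]
  refine sum_congr rfl fun i₂ _ => ?_
  rw [integral_finsetSum _ fun m₁ hm₁ => integrable_finsetSum _ fun m₂ hm₂ => hTi i₁ i₂ m₁ hm₁ m₂ hm₂]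
  refine sum_congr rfl fun m₁ hm₁ => ?_
  rw [integral_finsetSum _ fun m₂ hm₂ => hTi i₁ i₂ m₁ hm₁ m₂ hm₂]
  refine sum_congr rfl fun m₂ _ => ?_
  simp only [hT]
  rw [integral_const_mul]

end Literature.Barriers.Parity.MatomakiMerikoski
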